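import Summits.NavierStokesRegularity.NavierStokesRegularity.Theorems.StrainDoorsTypeITangentHessian
import Summits.NavierStokesRegularity.NavierStokesRegularity.Theorems.StrainDoorsPeakDoors
import HarnessLib

/-!
# StrainDoorsNearRecordSecondOrderRate — PART M §M8–§M9: THE SECOND-ORDER NEAR-RECORD LAWS WITH THE RATE `δ^{1/3}`

(Tree file 1 of 3 of PART M (§M8/§M9, ROUND 63 text C); text of nsreg-p1 r63/StrainDoorsNearRecordSecondOrderRate.lean sha256 97e6be56218c081e, split at the 400-line cap at § boundaries,
bodies verbatim.)

nsreg-p1 g36, ROUND-63 (helper lane of `stmt-NavierStokesRegularity-0056`, rung N0; 0 ledger writes by the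
planner — text for the S-lane, `--supports stmt-NavierStokesRegularity-0056 --as helper`; tree file 3 of 5 of
ROUND-63, independent of files 1–2; bodies farm-certified inside `r63/StrainDoorsR63All.lean`, rc 0 · 0 warn ·
0 sorry, std axioms).

§M8 (the `k = 4` KNSS window): `window_transfer_D4`, `exists_uniform_D4Bound` (`‖D⁴u(t,·)‖ ≤ K₄(C₀)` for
`t ≤ −1/4` in the classical Type-I class on `(−∞,0) × ℝ³`), `exists_uniform_D3Lipschitz` (`‖D³u‖ ≤ K₃`,
`‖D³u(t,x) − D³u(t,y)‖ ≤ K₄|x − y|`).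

§M9 (the laws): at a near-record of `|ω'|²` at time `−1` the symmetric second difference along a unit direction
`e` is `≤ 2(W² − |ω'(z)|²) ≤ 4Wδ`, and `∂_e∂_e|ω'|²` is Lipschitz along lines by §M8; the cubic symmetric Taylor
estimate gives `∂_e∂_e|ω'|²(z)·s² ≤ 4Wδ + 2K s³` for all `s > 0`, whence the RATE `δ^{1/3}`:
* `cube_le_of_forall_sq_le`, `abs_symm_second_difference_sub_le`, `second_deriv_cube_le_of_le` — Fermat at a
  near-maximum, SECOND ORDER, with a rate (one real variable);
* `fderiv_curl_nsRescale`, `fderiv_fderiv_curl_apply_nsRescale` — scale laws of `∇ω` (`λ³`) and `∂_e∂_e ω` (`λ⁴`);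
* ★★★ `typeI_vorticity_secondOrder_deficit` — `[(0 − t)³ (|∂_e ω|² + ⟪ω, ∂_e∂_e ω⟫)(t,x)]³ ≤ A(C₀)·W·δ` for
  every unit `e`, whenever `(0 − t)|ω(t,·)| ≤ W` at that instant and `(0 − t)|ω(t,x)| ≥ W − δ`;
* ★★ `typeI_vorticity_laplacian_deficit` — summed over a frame:
  `[(0 − t)³ (|∇ω|²_F + ⟪ω, Δω⟫)(t,x)]³ ≤ 27A·W·δ` (`½Δ|ω|² = |∇ω|²_F + ⟪ω,Δω⟫`);
* `typeI_vorticity_laplacian_nonpos_at_max` — sanity (`δ = 0`): the classical `Δ|ω|² ≤ 0` at a maximum.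

WHAT THIS IS NOT: necessary conditions at near-record points; nothing here excludes a blow-up; `0056` / `10661` /
NS regularity are NOT proved; the peak doors of PART K stay OPEN.  No new definitions; no sorry.
[cite: KochNadirashviliSereginSverak2009, §2 p. 5, §4 (4.11); ChaeWolf2017RemovingDSS, §3 Step 2;
ConstantinFefferman1993, §1]
-/

noncomputable section

open MeasureTheory Set Function Filter Metric Real InnerProductSpace
open _root_.Topology
open scoped ENNReal NNReal RealInnerProductSpace ContDiff Laplacian
open Literature.Analysis Literature.Analysis.FluidPDE
open Literature.Analysis.FluidPDE.VorticityDirectionDynamics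

set_option linter.dupNamespace false
set_option maxSynthPendingDepth 3

namespace Summit.NavierStokesRegularity.NavierStokesRegularity.Theorems.StrainDoors

open Summit.NavierStokesRegularity.NavierStokesRegularity.Theorems.ArgmaxDoors

/-! ## §M8 Fourth derivatives in the Type-I class (ROUND 63): the `k = 4` KNSS window -/

/-- Transfer of the KNSS window bound of order four to the classical field (copy of §M1's
`window_transfer_D3`, one order up). [folklore] -/
theorem window_transfer_D4 {T C₄ : ℝ}
    {w U : ℝ → (EuclideanSpace ℝ (Fin 3)) → (EuclideanSpace ℝ (Fin 3))} {b : ℝ → EuclideanSpace ℝ (Fin 3)}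
    (hw : IsSmoothSpaceTimeOn (Ioo 0 T) w)
    (hae : ∀ᵐ τ ∂((volume : Measure ℝ).restrict (Ioo 0 T)), w τ =ᵐ[volume] fun x => U τ x + b τ)
    (hUs : ∀ τ ∈ Ioo 0 T, ContDiff ℝ ∞ (U τ))
    (hUC : ∀ τ ∈ Ioo 1 T, ∀ x, ‖iteratedFDeriv ℝ 4 (U τ) x‖ ≤ C₄) :
    ∀ τ ∈ Ioo 1 T, ∀ x : EuclideanSpace ℝ (Fin 3), ‖iteratedFDeriv ℝ 4 (w τ) x‖ ≤ C₄ := by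
  have hSU : UniqueDiffOn ℝ (Ioo 0 T) := isOpen_Ioo.uniqueDiffOn
  have hsub1 : Ioo 1 T ⊆ Ioo 0 T := Ioo_subset_Ioo_left zero_le_one
  have hwx : ∀ τ ∈ Ioo 0 T, Continuous (w τ) := fun τ hτ => (hw.contDiff_slice hτ).continuous
  have hgood : ∀ᵐ τ ∂((volume : Measure ℝ).restrict (Ioo 0 T)),
      τ ∈ Ioo 0 T ∧ ∀ x, w τ x = U τ x + b τ := by
    filter_upwards [hae, ae_restrict_mem measurableSet_Ioo] with τ hτ hτm
    refine ⟨hτm, fun x => ?_⟩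
    have hc2 : Continuous fun x => U τ x + b τ := (hUs τ hτm).continuous.add continuous_const
    exact congr_fun ((Continuous.ae_eq_iff_eq volume (hwx τ hτm) hc2).1 hτ) x
  have hgood1 : ∀ᵐ τ ∂((volume : Measure ℝ).restrict (Ioo 1 T)),
      τ ∈ Ioo 0 T ∧ ∀ x, w τ x = U τ x + b τ :=
    ae_restrict_of_ae_restrict_of_subset hsub1 hgood
  intro τ₀ hτ₀ x
  have hcont : ContinuousOn (fun τ => ‖iteratedFDeriv ℝ 4 (w τ) x‖) (Ioo 1 T) := by
    have h1 := ((((hw.fderiv_slice hSU).fderiv_slice hSU).fderiv_slice hSU).continuousOn_fderiv_slice hSU).comp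
      (continuousOn_id.prodMk continuousOn_const) (fun τ hτ => mk_mem_prod hτ (mem_univ x))
    have h2 : ContinuousOn
        (fun τ => ‖fderiv ℝ (fun y => fderiv ℝ (fun y' => fderiv ℝ (fun y'' => fderiv ℝ (w τ) y'') y') y) x‖)
        (Ioo 1 T) :=
      (h1.mono hsub1).norm
    refine h2.congr fun τ _ => ?_
    show ‖iteratedFDeriv ℝ 4 (w τ) x‖ =
      ‖fderiv ℝ (fun y => fderiv ℝ (fun y' => fderiv ℝ (fun y'' => fderiv ℝ (w τ) y'') y') y) x‖
    rw [← norm_iteratedFDeriv_fderiv, ← norm_iteratedFDeriv_fderiv, ← norm_iteratedFDeriv_fderiv,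
      ChaeWolf.norm_iteratedFDeriv_one_eq_norm_fderiv]
  refine ChaeWolf.le_of_ae_le_of_continuousOn hcont ?_ τ₀ hτ₀
  filter_upwards [hgood1, ae_restrict_mem measurableSet_Ioo] with τ hτ hτ1
  have heq : w τ = (U τ + fun _ => b τ) := funext hτ.2
  have hU4 : ContDiffAt ℝ (4 : ℕ) (U τ) x :=
    ((hUs τ hτ.1).of_le (m := (4 : ℕ)) (by norm_cast)).contDiffAt
  have hb4 : ContDiffAt ℝ (4 : ℕ) (fun _ : EuclideanSpace ℝ (Fin 3) => b τ) x := contDiffAt_const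
  rw [heq, iteratedFDeriv_add_apply hU4 hb4, iteratedFDeriv_const_of_ne (by norm_num) (b τ),
    Pi.zero_apply, add_zero]
  exact hUC τ hτ1 x

/-- **Uniform fourth-derivative bound in the Type-I class** (KNSS 2009 §4, `k = 4`, on the window
`(t − 2, t + 1/8)`): `‖D⁴u(t,x)‖ ≤ K₄` for all `t ≤ −1/4`. [cite: KochNadirashviliSereginSverak2009, §4 (4.11)] -/
theorem exists_uniform_D4Bound {C₀ : ℝ} (hC₀ : 0 ≤ C₀) :
    ∃ K₄ : ℝ, 0 ≤ K₄ ∧ ∀ {u : ℝ → EuclideanSpace ℝ (Fin 3) → EuclideanSpace ℝ (Fin 3)}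
      {p : ℝ → EuclideanSpace ℝ (Fin 3) → ℝ},
      IsClassicalNSSolutionOn (Iio 0) 1 0 u p → HasTypeIDecay C₀ u →
        ∀ t ≤ -(1 / 4 : ℝ), ∀ x, ‖iteratedFDeriv ℝ 4 (u t) x‖ ≤ K₄ := by
  obtain ⟨Cw, Lw, N, hwin⟩ :=
    KNSS2009_regularity_boundedWeak_window_holds (3 * C₀) (17 / 8) (by norm_num)
  refine ⟨max (Cw 4 1) 0, le_max_right _ _, ?_⟩
  intro u p hcl hI t ht x
  set a : ℝ := t - 2 with ha
  set w : ℝ → EuclideanSpace ℝ (Fin 3) → EuclideanSpace ℝ (Fin 3) := fun τ => u (τ + a) with hw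
  have hIoo : Ioo a (a + 17 / 8) ⊆ Iio 0 := fun τ hτ => by
    simp only [mem_Iio]; linarith [hτ.2]
  have hneg : ∀ τ ∈ Ioo (0 : ℝ) (17 / 8), τ + a < -(1 / 8 : ℝ) := fun τ hτ => by
    linarith [hτ.2]
  have hcl' : IsClassicalNSSolutionOn (Ioo a (a + 17 / 8)) 1 0 u p :=
    hcl.mono hIoo (uniqueDiffOn_Ioo _ _)
  have hbdd : IsBoundedOn (Ioo a (a + 17 / 8)) u :=
    ⟨3 * C₀, fun τ hτ x => ChaeWolf.typeI_norm_le_three_mul hC₀ hI (by linarith [hτ.2]) x⟩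
  have hweak : IsBoundedWeakNSSolutionOn (Ioo 0 (17 / 8)) isOpen_Ioo 1 w :=
    (hcl'.isBoundedWeakNSSolutionOn hbdd).comp_add_right a (J := Ioo 0 (17 / 8)) isOpen_Ioo
      fun τ => by
        simp only [mem_Ioo]
        constructor <;> intro h <;> constructor <;> linarith [h.1, h.2]
  have hM : ∀ τ ∈ Ioo (0 : ℝ) (17 / 8), ∀ x, ‖w τ x‖ ≤ 3 * C₀ := fun τ hτ x =>
    ChaeWolf.typeI_norm_le_three_mul hC₀ hI (hneg τ hτ) x
  obtain ⟨U, b, -, -, -, hae, hUs, -, hUC, -, -⟩ := hwin hweak hM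
  have hws : IsSmoothSpaceTimeOn (Ioo 0 (17 / 8)) w := by
    have h1 := hcl.smooth_velocity.comp_add_right a
    refine h1.mono fun τ hτ => ?_
    simp only [mem_preimage, mem_Iio]
    linarith [hneg τ hτ]
  have key := window_transfer_D4 hws hae hUs (hUC 1 one_pos 4)
  have h2 : (2 : ℝ) ∈ Ioo (1 : ℝ) (17 / 8) := ⟨by norm_num, by norm_num⟩
  have e2 : w 2 = u t := by simp only [hw, ha]; congr 1; ring
  have := key 2 h2 x
  rw [e2] at this
  exact this.trans (le_max_left _ _)

/-- **Uniform third-derivative bound and third-derivative Lipschitz bound in the Type-I class**, in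
`∇∇∇` form: `‖D³u(t,x)‖ ≤ K₃` and `‖D³u(t,x) − D³u(t,y)‖ ≤ K₄|x − y|` for `t ≤ −1/4` (mean value inequality
with the `k = 4` window). [folklore] -/
theorem exists_uniform_D3Lipschitz {C₀ : ℝ} (hC₀ : 0 ≤ C₀) :
    ∃ K₃ K₄ : ℝ, 0 ≤ K₃ ∧ 0 ≤ K₄ ∧ ∀ {u : ℝ → EuclideanSpace ℝ (Fin 3) → EuclideanSpace ℝ (Fin 3)}
      {p : ℝ → EuclideanSpace ℝ (Fin 3) → ℝ},
      IsClassicalNSSolutionOn (Iio 0) 1 0 u p → HasTypeIDecay C₀ u →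
        (∀ t ≤ -(1 / 4 : ℝ), ∀ x, ‖fderiv ℝ (fderiv ℝ (fderiv ℝ (u t))) x‖ ≤ K₃) ∧
        (∀ t ≤ -(1 / 4 : ℝ), ∀ x y,
          ‖fderiv ℝ (fderiv ℝ (fderiv ℝ (u t))) x - fderiv ℝ (fderiv ℝ (fderiv ℝ (u t))) y‖ ≤ K₄ * ‖x - y‖) := by
  obtain ⟨K₃, hK₃, hD3⟩ := exists_uniform_D3Bound hC₀
  obtain ⟨K₄, hK₄, hD4⟩ := exists_uniform_D4Bound hC₀
  refine ⟨K₃, K₄, hK₃, hK₄, @fun u p hcl hI => ⟨fun t ht x => ?_, fun t ht x y => ?_⟩⟩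
  · rw [← norm_iteratedFDeriv_zero (𝕜 := ℝ) (f := fderiv ℝ (fderiv ℝ (fderiv ℝ (u t)))),
      norm_iteratedFDeriv_fderiv, norm_iteratedFDeriv_fderiv, norm_iteratedFDeriv_fderiv]
    exact hD3 hcl hI t ht x
  · have ht0 : t ∈ Iio (0 : ℝ) := by simp only [mem_Iio]; linarith
    have hd : Differentiable ℝ (fderiv ℝ (fderiv ℝ (fderiv ℝ (u t)))) :=
      ((((hcl.contDiff_velocity ht0).fderiv_right (m := 3) (by norm_cast)).fderiv_right (m := 2)
        (by norm_cast)).fderiv_right (m := 1) (by norm_cast)).differentiable (by norm_cast)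
    have hdiff : ∀ z ∈ (univ : Set (EuclideanSpace ℝ (Fin 3))),
        DifferentiableAt ℝ (fderiv ℝ (fderiv ℝ (fderiv ℝ (u t)))) z := fun z _ => hd z
    have hbound : ∀ z ∈ (univ : Set (EuclideanSpace ℝ (Fin 3))),
        ‖fderiv ℝ (fderiv ℝ (fderiv ℝ (fderiv ℝ (u t)))) z‖ ≤ K₄ := by
      intro z _
      rw [← norm_iteratedFDeriv_zero (𝕜 := ℝ) (f := fderiv ℝ (fderiv ℝ (fderiv ℝ (fderiv ℝ (u t))))),
        norm_iteratedFDeriv_fderiv, norm_iteratedFDeriv_fderiv, norm_iteratedFDeriv_fderiv,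
        norm_iteratedFDeriv_fderiv]
      exact hD4 hcl hI t ht z
    exact Convex.norm_image_sub_le_of_norm_fderiv_le hdiff hbound convex_univ (mem_univ y)
      (mem_univ x)

/-! ## §M9 The second-order near-record laws WITH A RATE (ROUND 63)

At a near-record of `|ω'|²` at time `−1` the symmetric second difference along any unit direction `e` is
`≤ 2(W² − |ω'(z)|²) ≤ 4Wδ`; the uniform `C^{3,1}` bounds of the Type-I class (§M8: the `k = 4` KNSS window)
make the second directional derivative of `|ω'|²` Lipschitz along lines, so the cubic symmetric Taylor
estimate gives `∂_e∂_e|ω'|²(z) · s² ≤ 4Wδ + 2K s³` for all `s > 0`, whence `(∂_e∂_e|ω'|²(z))³ ≤ 128 K² W δ`: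
a second-order law with the rate `δ^{1/3}`, compactness-free. -/

/-- Real-variable lemma: if `a s² ≤ b + c s³` for all `s > 0` (`b, c ≥ 0`) then `a³ ≤ 8 b c²`. [folklore] -/
theorem cube_le_of_forall_sq_le {a b c : ℝ} (hb : 0 ≤ b) (hc : 0 ≤ c)
    (h : ∀ s : ℝ, 0 < s → a * s ^ 2 ≤ b + c * s ^ 3) : a ^ 3 ≤ 8 * b * c ^ 2 := by
  rcases le_or_gt a 0 with ha | ha
  · exact (Odd.pow_nonpos (⟨1, by norm_num⟩ : Odd 3) ha).trans (by positivity)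
  rcases hc.eq_or_lt with hc0 | hc0
  · have h1 := h (b / a + 1) (by positivity)
    rw [← hc0, zero_mul, add_zero] at h1
    have hba : 0 ≤ b / a := by positivity
    have h2 : a * (b / a + 1) ≤ a * (b / a + 1) ^ 2 :=
      mul_le_mul_of_nonneg_left (by nlinarith) ha.le
    have e : a * (b / a + 1) = b + a := by field_simp
    linarith
  · have h1 := h (a / (2 * c)) (by positivity)
    have e1 : a * (a / (2 * c)) ^ 2 = 2 * (a ^ 3 / (8 * c ^ 2)) := by field_simp; ring
    have e2 : c * (a / (2 * c)) ^ 3 = a ^ 3 / (8 * c ^ 2) := by field_simp; ring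
    have h2 : a ^ 3 / (8 * c ^ 2) ≤ b := by linarith
    rw [div_le_iff₀ (by positivity)] at h2
    linarith

/-- **Cubic symmetric Taylor estimate in one variable.**  If `G' = dG/ds`, `G'' = dG'/ds` and
`|G''(s) − G''(0)| ≤ K|s|`, then `|G(s) + G(−s) − 2G(0) − G''(0)s²| ≤ 2K s³` for `s ≥ 0` (mean value
inequality twice). [folklore] -/
theorem abs_symm_second_difference_sub_le {G G' G'' : ℝ → ℝ} {K : ℝ} (hK : 0 ≤ K)
    (hG : ∀ s, HasDerivAt G (G' s) s) (hG' : ∀ s, HasDerivAt G' (G'' s) s)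
    (hL : ∀ s, |G'' s - G'' 0| ≤ K * |s|) {s : ℝ} (hs : 0 ≤ s) :
    |G s + G (-s) - 2 * G 0 - G'' 0 * s ^ 2| ≤ 2 * K * s ^ 3 := by
  -- first-order Taylor of `G'` with the Lipschitz rate, on both sides of `0`
  have hφd : ∀ σ : ℝ, HasDerivAt (fun τ => G' τ - G' 0 - G'' 0 * τ) (G'' σ - G'' 0) σ := fun σ =>
    (((hG' σ).sub_const (G' 0)).sub ((hasDerivAt_id σ).const_mul (G'' 0))).congr_deriv (by simp)
  have hφ : ∀ σ : ℝ, |G' σ - G' 0 - G'' 0 * σ| ≤ K * σ ^ 2 := by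
    intro σ
    rcases le_total 0 σ with hσ | hσ
    · have hbound : ∀ τ ∈ Ico 0 σ, ‖G'' τ - G'' 0‖ ≤ K * σ := fun τ hτ => by
        rw [Real.norm_eq_abs]
        exact (hL τ).trans (by rw [abs_of_nonneg hτ.1]; exact mul_le_mul_of_nonneg_left hτ.2.le hK)
      have h := norm_image_sub_le_of_norm_deriv_le_segment' (fun τ _ => (hφd τ).hasDerivWithinAt) hbound
        σ (right_mem_Icc.mpr hσ)
      simp only [mul_zero, sub_zero, sub_self, Real.norm_eq_abs] at h
      calc |G' σ - G' 0 - G'' 0 * σ| ≤ K * σ * σ := h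
        _ = K * σ ^ 2 := by ring
    · have hbound : ∀ τ ∈ Ico σ 0, ‖G'' τ - G'' 0‖ ≤ K * (-σ) := fun τ hτ => by
        rw [Real.norm_eq_abs]
        refine (hL τ).trans ?_
        rw [abs_of_nonpos hτ.2.le]
        exact mul_le_mul_of_nonneg_left (by linarith [hτ.1]) hK
      have h := norm_image_sub_le_of_norm_deriv_le_segment' (fun τ _ => (hφd τ).hasDerivWithinAt) hbound
        0 (left_mem_Icc.mpr hσ |> fun h => right_mem_Icc.mpr hσ)
      simp only [mul_zero, sub_self, Real.norm_eq_abs, zero_sub, abs_neg] at h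
      calc |G' σ - G' 0 - G'' 0 * σ| ≤ K * -σ * -σ := h
        _ = K * σ ^ 2 := by ring
  -- the symmetric combination `ψ(σ) = G σ + G(−σ) − G''(0) σ²` has `|ψ'| ≤ 2Kσ²`
  have hψd : ∀ σ : ℝ, HasDerivAt (fun τ => G τ + G (-τ) - G'' 0 * τ ^ 2)
      (G' σ - G' (-σ) - G'' 0 * (2 * σ)) σ := by
    intro σ
    have h1 : HasDerivAt (fun τ => G (-τ)) (-G' (-σ)) σ := by
      have := (hG (-σ)).comp σ (hasDerivAt_neg' σ)
      simpa [Function.comp_def] using this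
    have h2 : HasDerivAt (fun τ : ℝ => G'' 0 * τ ^ 2) (G'' 0 * (2 * σ)) σ := by
      simpa using ((hasDerivAt_pow 2 σ).const_mul (G'' 0))
    exact (((hG σ).add h1).sub h2).congr_deriv (by ring)
  have hψb : ∀ σ ∈ Ico 0 s, ‖G' σ - G' (-σ) - G'' 0 * (2 * σ)‖ ≤ 2 * K * s ^ 2 := by
    intro σ hσ
    rw [Real.norm_eq_abs,
      show G' σ - G' (-σ) - G'' 0 * (2 * σ) =
        (G' σ - G' 0 - G'' 0 * σ) - (G' (-σ) - G' 0 - G'' 0 * (-σ)) by ring]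
    refine (abs_sub _ _).trans ?_
    have hσs : σ ^ 2 ≤ s ^ 2 := by nlinarith [hσ.1, hσ.2]
    calc |G' σ - G' 0 - G'' 0 * σ| + |G' (-σ) - G' 0 - G'' 0 * -σ| ≤ K * σ ^ 2 + K * (-σ) ^ 2 :=
          add_le_add (hφ σ) (hφ (-σ))
      _ = 2 * K * σ ^ 2 := by ring
      _ ≤ 2 * K * s ^ 2 := by nlinarith
  have h := norm_image_sub_le_of_norm_deriv_le_segment' (fun σ _ => (hψd σ).hasDerivWithinAt) hψb s
    (right_mem_Icc.mpr hs)
  simp only [neg_zero, mul_zero, sub_zero, Real.norm_eq_abs, ne_eq, OfNat.ofNat_ne_zero,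
    not_false_eq_true, zero_pow] at h
  calc |G s + G (-s) - 2 * G 0 - G'' 0 * s ^ 2| = |G s + G (-s) - G'' 0 * s ^ 2 - (G 0 + G 0)| := by
        ring_nf
    _ ≤ 2 * K * s ^ 2 * s := h
    _ = 2 * K * s ^ 3 := by ring

/-- **Fermat at a near-maximum, second order, WITH A RATE.**  If `G ≤ M` everywhere and `G''` is `K`-Lipschitz
at `0` in the sense `|G''(s) − G''(0)| ≤ K|s|`, then `G''(0)³ ≤ 64 K² (M − G(0))`. [folklore] -/
theorem second_deriv_cube_le_of_le {G G' G'' : ℝ → ℝ} {K M : ℝ} (hK : 0 ≤ K)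
    (hG : ∀ s, HasDerivAt G (G' s) s) (hG' : ∀ s, HasDerivAt G' (G'' s) s)
    (hL : ∀ s, |G'' s - G'' 0| ≤ K * |s|) (hM : ∀ s, G s ≤ M) :
    G'' 0 ^ 3 ≤ 64 * K ^ 2 * (M - G 0) := by
  have key : ∀ s : ℝ, 0 < s → G'' 0 * s ^ 2 ≤ 2 * (M - G 0) + 2 * K * s ^ 3 := fun s hs => by
    have h1 := (abs_le.mp (abs_symm_second_difference_sub_le hK hG hG' hL hs.le)).1
    linarith [hM s, hM (-s)]
  have h := cube_le_of_forall_sq_le (by linarith [hM 0]) (by positivity) key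
  calc G'' 0 ^ 3 ≤ 8 * (2 * (M - G 0)) * (2 * K) ^ 2 := h
    _ = 64 * K ^ 2 * (M - G 0) := by ring

/-- Scale law of the VORTICITY GRADIENT: `∇ω'(s,y) = λ³ (∇ω)(λ²s, λy)`. [folklore] (The tree's `FiniteDissipationLiouville.EndpointScheme.fderiv_curl_nsRescale` is the same identity with `c * c * c`;
restated here in the `c ^ 2 * c` form used below, to avoid importing the Leray endpoint chain into StrainDoors.) -/
theorem fderiv_curl_nsRescale (c : ℝ) (u : ℝ → EuclideanSpace ℝ (Fin 3) → EuclideanSpace ℝ (Fin 3))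
    (s : ℝ) (y : EuclideanSpace ℝ (Fin 3)) :
    fderiv ℝ (curl (nsRescale c u s)) y = (c ^ 2 * c) • fderiv ℝ (curl (u (c ^ 2 * s))) (c • y) := by
  have h1 : curl (nsRescale c u s) =
      fun y : EuclideanSpace ℝ (Fin 3) => c ^ 2 • curl (u (c ^ 2 * s)) (c • y) := by
    funext y
    rw [curl_eq_curlCLM, curl_eq_curlCLM, fderiv_nsRescale, map_smul]
  rw [h1]
  exact fderiv_const_smul_comp_smul' (curl (u (c ^ 2 * s))) (c ^ 2) c y

/-- Scale law of the SECOND DIRECTIONAL DERIVATIVE of the vorticity: `∂_e(∂_e ω')(s,y) = λ⁴ (∂_e∂_e ω)(λ²s, λy)`.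
[folklore] -/
theorem fderiv_fderiv_curl_apply_nsRescale (c : ℝ)
    (u : ℝ → EuclideanSpace ℝ (Fin 3) → EuclideanSpace ℝ (Fin 3)) (s : ℝ) (y e : EuclideanSpace ℝ (Fin 3)) :
    fderiv ℝ (fun y => fderiv ℝ (curl (nsRescale c u s)) y e) y =
      (c ^ 2 * c * c) • fderiv ℝ (fun y => fderiv ℝ (curl (u (c ^ 2 * s))) y e) (c • y) := by
  have h1 : (fun y => fderiv ℝ (curl (nsRescale c u s)) y e) =
      fun y : EuclideanSpace ℝ (Fin 3) =>
        (c ^ 2 * c) • (fun y' => fderiv ℝ (curl (u (c ^ 2 * s))) y' e) (c • y) := by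
    funext y
    rw [fderiv_curl_nsRescale]
    rfl
  rw [h1]
  exact fderiv_const_smul_comp_smul' (fun y' => fderiv ℝ (curl (u (c ^ 2 * s))) y' e) (c ^ 2 * c) c y

end Summit.NavierStokesRegularity.NavierStokesRegularity.Theorems.StrainDoors

end
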